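import Literature.MathematicalPhysics.QuantumFieldTheory.King1986.CovarianceSplitting
import Literature.MathematicalPhysics.QuantumFieldTheory.King1986.MinimizerTowerBridge
import HarnessLib

/-!
# King 1986, (2.17) with (2.20): the level-`(k+1)` propagator of the splitting IS `G^ε_{k+1}` of (2.13) in its own
# units — the flat re-indexing `Tor (fine N (fine L M)) ≃ Tor (fine (N·L) M)` and the rescaling of operators (2.20)

**Citation header (sequel of `King1986/CovarianceSplitting`, same seat `pub-ymgap-dag-n15-e` (generation 5) of the cell
`pub-ymgap`, Track-A node N15 = NE2, King-model rung).**  C. King, *The U(1) Higgs model. I. The continuum limit*, Commun.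
Math. Phys. **102** (1986) 649–677 [King1986], §2.2 p. 653 (2.13)–(2.17), p. 654 (2.20).  Page images READ AS IMAGE by this
seat: `pub-balaban/b2b-balaban-template/king-renders/1986-cmp102-king-u1-higgs-I-p005-x2.png`, `…-p006-x2.png`.  TEMPLATE
LITERATURE (`A = 0` scalar block-spin MODEL); nothing here is about Bałaban's covariant objects.

**What King prints (verbatim, p. 654).**  «Finally we note how operators transform under rescalings of the lattice. If we
rescale εZ^d to ηZ^d, the following relations hold between the operators on those lattices:  G^ε_k(Ω, x, y) =
(ε∕η)^{2−d}G^η_k((η∕ε)Ω, ηx∕ε, ηy∕ε) … (2.20)  When η = L^{−k} we will omit the lattice superscript.»  (With (2.13) p. 653: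
«G^ε_k(Ω, A) = (−Δ^{ε,Ω}_A + m² + a_k(L^kε)^{−2}Q_k(A)^*Q_k(A))^{−1}».)

**The point.**  `CovarianceSplitting.constrainedProp₂_eq` proves King's (2.17) one step, `G^ε_{k+1} = G^ε_k + ℋ_kC^{(k)}ℋ_kᵀ`,
with the level-`(k+1)` propagator written in LEVEL-`k` UNITS on the NESTED torus `Tor (fine N (fine L M))` as
`constrainedProp₂ = N^d·(B + b·Q₂^*Q₂)⁻¹` (`b = a_{k+1}∕L²`).  This file identifies that object with the tree's ONE-level
propagator `constrainedProp (N·L) M a_{k+1} ((NL)²) (L²m²) = (NL)^d·A₀⁻¹` — (2.13) AT LEVEL `k + 1` IN ITS OWN UNITS on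
the FLAT torus `Tor (fine (N·L) M)` — up to EXACTLY King's rescaling factor of (2.20): the flat re-indexing carries
`c(−Δ) + m²` to itself and the composite projector `Q₂^*Q₂` to `blockProj (N·L) M`, and passing from level-`k` units
(fine spacing `N⁻¹`, `c = N²`, mass `m²`) to level-`(k+1)` units (fine spacing `(NL)⁻¹`, `c = (NL)²`, mass `L²m²`)
multiplies `B + b·Q₂^*Q₂` by `L²`, whence the kernel picks up `(NL)^d·L^{−2}∕N^d = L^{d−2} = (ε′∕ε)^{2−d}`.

**What this file PROVES (kernel).**
* §1 entry formulas `Qmat₂_apply` (`Q_{k+1}(z, x) = (NL)^{−d}·[x ∈ composite block z]`), `blockProj₂_apply`;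
* §2 the flat re-indexing `flatten : Tor (fine N (fine L M)) ≃ Tor (fine (N·L) M)` (coordinatewise `ZMod.ringEquivCongr`
  along `N·(L·M_μ) = (N·L)·M_μ`; `val_flatten`, `flatten_add`, `flatten_sub`, `flatten_unitVec`), `blockOf_flatten`
  (`⌊⌊x∕N⌋∕L⌋ = ⌊x∕(NL)⌋`), **`lapF_flatten`** (`c(−Δ) + m²` is carried to itself), **`blockProj_flatten`**
  (`blockProj (N·L) M ∘ flatten = blockProj₂`), `lapF_scale` (`lapF (sc) (sm²) = s·lapF c m²`);
* §3 **`fineOp_succ_eq_reindex`**: `fineOp (N·L) M a₂ (L²c) (L²m²) = reindex flatten flatten (L²·(lapF c m² + (a₂∕L²)·Q₂^*Q₂))`,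
  `isUnit_lapF_add_blockProj₂`, and **`constrainedProp_flatten`**: `constrainedProp (N·L) M (L²b) (L²c) (L²m²) (flatten x)
  (flatten y) = (L^d∕L²)·constrainedProp₂ N L M a₁ a c m² x y` (`b = nextLevelCoeff a a₁ L`); at King's parameters
  (`a₁ = a_k`, `c = N²`, `L²b = a_{k+1}` by `nextLevelCoeff_aK`) **`constrainedProp_succ_flatten`**:
  `G^ε_{k+1}[own units](flatten x, flatten y) = L^{d−2}·G^ε_{k+1}[level-k units](x, y)` — (2.20); and the BY-NAME form of
  (2.17) one step, **`king217_oneStep`**: `L^{2−d}·constrainedProp (N·L) M a_{k+1} ((NL)²) (L²m²) (flatten x) (flatten y) −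
  constrainedProp N (fine L M) a_k (N²) m² x y = Σ_w (Σ_z ℋ_k(x, z)·C^{(k)}(z, w))·ℋ_k(y, w)`.

**NOT COVERED.**  The `k`-fold telescoped sum (2.17) on one torus (iterate `flatten`); free boundary conditions; `A ≠ 0`.
HONEST FRAMING: King's scalar block-spin MODEL on a finite torus — exact finite-dimensional algebra and index bookkeeping;
nothing about Bałaban's covariant objects; nothing continuum ∕ mass-gap ∕ Clay; count-neutral for the cell's 27 nodes.
-/

noncomputable section

open Finset Real Matrix
open scoped BigOperators

namespace Literature.MathematicalPhysics.QuantumFieldTheory.King1986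

open Literature.MathematicalPhysics.QuantumFieldTheory.Balaban1983to89
open Literature.MathematicalPhysics.QuantumFieldTheory.Balaban1983to89.B5Prop11Plancherel

namespace Torus

variable {d : ℕ}

section TwoLevel

variable (N L : ℕ) [NeZero N] [NeZero L] (M : Fin d → ℕ) [hM : ∀ μ, NeZero (M μ)]

/-! ## §1 Entry formulas of the composite mean and projector -/

/-- `Q_{k+1}(z, x) = (NL)^{−d}·[x lies in the composite block z]`. [cite: King1986, (2.10) p.653] -/
theorem Qmat₂_apply (z : Tor M) (x : Tor (fine N (fine L M))) :
    Qmat₂ N L M z x = if blockOf L M (blockOf N (fine L M) x) = z then ((((N : ℝ) * L) ^ d)⁻¹) else 0 := by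
  rw [Qmat₂, Matrix.mul_apply, Finset.sum_eq_single (blockOf N (fine L M) x)]
  · simp only [Qmat, if_true]
    by_cases h : blockOf L M (blockOf N (fine L M) x) = z
    · rw [if_pos h, if_pos h, mul_pow, mul_inv, mul_comm]
    · rw [if_neg h, if_neg h, zero_mul]
  · intro y _ hy
    simp only [Qmat]
    rw [if_neg (Ne.symm hy), mul_zero]
  · intro h; exact absurd (Finset.mem_univ _) h

/-- `(Q_{k+1}^*Q_{k+1})(x, x′) = (NL)^{−d}·[x, x′ in the same composite block]`. [cite: King1986, (4.36) p.674] -/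
theorem blockProj₂_apply (x x' : Tor (fine N (fine L M))) :
    blockProj₂ N L M x x'
      = if blockOf L M (blockOf N (fine L M) x) = blockOf L M (blockOf N (fine L M) x')
        then ((((N : ℝ) * L) ^ d)⁻¹) else 0 := by
  have hNL : (((N : ℝ) * L) ^ d) ≠ 0 :=
    pow_ne_zero _ (mul_ne_zero (by exact_mod_cast NeZero.ne N) (by exact_mod_cast NeZero.ne L))
  rw [blockProj₂, Matrix.smul_apply, Matrix.mul_apply, smul_eq_mul,
    Finset.sum_eq_single (blockOf L M (blockOf N (fine L M) x))]
  · rw [Matrix.transpose_apply, Qmat₂_apply, Qmat₂_apply, if_pos rfl]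
    by_cases h : blockOf L M (blockOf N (fine L M) x) = blockOf L M (blockOf N (fine L M) x')
    · rw [if_pos h.symm, if_pos h, ← mul_assoc, mul_inv_cancel₀ hNL, one_mul]
    · rw [if_neg (fun h' => h h'.symm), if_neg h, mul_zero, mul_zero]
  · intro z _ hz
    rw [Matrix.transpose_apply, Qmat₂_apply, if_neg (Ne.symm hz), zero_mul]
  · intro h; exact absurd (Finset.mem_univ _) h

/-! ## §2 The flat re-indexing `Tor (fine N (fine L M)) ≃ Tor (fine (N·L) M)` -/

omit [NeZero N] [NeZero L] hM in
/-- `N·(L·M_μ) = (N·L)·M_μ`: the nested and the flat fine torus have the same number of sites per direction. [cite: King1986, (2.10) p.653, (2.20) p.654] -/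
theorem fine_fine (μ : Fin d) : fine N (fine L M) μ = fine (N * L) M μ :=
  (Nat.mul_assoc N L (M μ)).symm

/-- THE FLAT RE-INDEXING of the nested torus: coordinatewise the canonical isomorphism `ℤ/(N·(L·M_μ)) ≅ ℤ/((N·L)·M_μ)`.
[cite: King1986, (2.20) p.654 (rescaling of the lattice)] -/
def flatten : Tor (fine N (fine L M)) ≃ Tor (fine (N * L) M) :=
  Equiv.piCongrRight fun μ => (ZMod.ringEquivCongr (fine_fine N L M μ)).toEquiv

omit [NeZero N] [NeZero L] hM in
/-- Coordinate form of `flatten`. [cite: King1986, (2.20) p.654] -/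
theorem flatten_apply (x : Tor (fine N (fine L M))) (μ : Fin d) :
    flatten N L M x μ = ZMod.ringEquivCongr (fine_fine N L M μ) (x μ) := rfl

omit [NeZero N] [NeZero L] hM in
/-- `flatten` preserves the integer representatives (it is the identity on sites). [cite: King1986, (2.20) p.654] -/
theorem val_flatten (x : Tor (fine N (fine L M))) (μ : Fin d) : (flatten N L M x μ).val = (x μ).val := by
  rw [flatten_apply, ZMod.ringEquivCongr_val]

omit [NeZero N] [NeZero L] hM in
/-- `flatten` is additive. [cite: King1986, (2.20) p.654] -/
theorem flatten_add (x y : Tor (fine N (fine L M))) : flatten N L M (x + y) = flatten N L M x + flatten N L M y := by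
  funext μ
  rw [Pi.add_apply, flatten_apply, flatten_apply, flatten_apply, Pi.add_apply, map_add]

omit [NeZero N] [NeZero L] hM in
/-- `flatten` respects subtraction. [cite: King1986, (2.20) p.654] -/
theorem flatten_sub (x y : Tor (fine N (fine L M))) : flatten N L M (x - y) = flatten N L M x - flatten N L M y := by
  funext μ
  rw [Pi.sub_apply, flatten_apply, flatten_apply, flatten_apply, Pi.sub_apply, map_sub]

omit [NeZero N] [NeZero L] hM in
/-- `flatten` carries lattice unit vectors to lattice unit vectors (nearest neighbours are preserved). [cite: King1986, (2.20) p.654] -/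
theorem flatten_unitVec (μ : Fin d) :
    flatten N L M (unitVec (fine N (fine L M)) μ) = unitVec (fine (N * L) M) μ := by
  funext ν
  rw [flatten_apply, unitVec, unitVec]
  by_cases h : ν = μ
  · subst h
    rw [Pi.single_eq_same, Pi.single_eq_same, map_one]
  · rw [Pi.single_eq_of_ne h, Pi.single_eq_of_ne h, map_zero]

/-- **Blocks correspond**: the `(N·L)`-block of the flattened site is the `L`-block of its `N`-block, `⌊⌊x∕N⌋∕L⌋ = ⌊x∕(NL)⌋`.
[cite: King1986, (2.10) p.653 (nested blocks `B^k(y)`)] -/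
theorem blockOf_flatten (x : Tor (fine N (fine L M))) :
    blockOf (N * L) M (flatten N L M x) = blockOf L M (blockOf N (fine L M) x) := by
  funext μ
  apply ZMod.val_injective
  rw [val_blockOf, val_blockOf, val_blockOf, val_flatten, Nat.div_div_eq_div_mul]

omit [NeZero N] [NeZero L] hM in
/-- **`c(−Δ) + m²` is carried to itself** by the flat re-indexing (same nearest neighbours). [cite: King1986, (2.20) p.654] -/
theorem lapF_flatten (c m2 : ℝ) (x y : Tor (fine N (fine L M))) :
    lapF (fine (N * L) M) c m2 (flatten N L M x) (flatten N L M y) = lapF (fine N (fine L M)) c m2 x y := by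
  simp only [lapF, ← flatten_unitVec N L M, ← flatten_add, ← flatten_sub, (flatten N L M).injective.eq_iff]

/-- **The composite projector IS the one-level projector of the flat torus**: `blockProj (N·L) M (flatten x) (flatten x′) =
blockProj₂ N L M x x′`. [cite: King1986, (2.13) p.653 (the term `Q_{k+1}^*Q_{k+1}`)] -/
theorem blockProj_flatten (x x' : Tor (fine N (fine L M))) :
    blockProj (N * L) M (flatten N L M x) (flatten N L M x') = blockProj₂ N L M x x' := by
  rw [blockProj₂_apply, blockProj, blockOf_flatten, blockOf_flatten, Nat.cast_mul]

omit [NeZero N] [NeZero L] hM in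
/-- Change of units in `c(−Δ) + m²`: `lapF (s·c) (s·m²) = s·lapF c m²`. [cite: King1986, (2.20) p.654] -/
theorem lapF_scale (K : Fin d → ℕ) [∀ μ, NeZero (K μ)] (s c m2 : ℝ) :
    lapF K (s * c) (s * m2) = s • lapF K c m2 := by
  ext z z'
  simp only [lapF, Matrix.smul_apply, smul_eq_mul]
  ring

/-! ## §3 `G^ε_{k+1}` in its own units on the flat torus vs. `constrainedProp₂` -/

/-- **The level-`(k+1)` minimisation operator in its own units is the re-indexed, `L²`-rescaled operator of the splitting**:
`fineOp (N·L) M a₂ (L²c) (L²m²) = reindex flatten flatten (L²·(lapF c m² + (a₂∕L²)·Q₂^*Q₂))`.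
[cite: King1986, (2.13) p.653, (2.20) p.654] -/
theorem fineOp_succ_eq_reindex (a₂ c m2 : ℝ) :
    fineOp (N * L) M a₂ (((L : ℝ) ^ 2) * c) (((L : ℝ) ^ 2) * m2)
      = Matrix.reindex (flatten N L M) (flatten N L M)
          (((L : ℝ) ^ 2) • (lapF (fine N (fine L M)) c m2 + (a₂ * ((L : ℝ) ^ 2)⁻¹) • blockProj₂ N L M)) := by
  have hL2 : ((L : ℝ) ^ 2) ≠ 0 := pow_ne_zero _ (by exact_mod_cast NeZero.ne L)
  ext i j
  obtain ⟨x, rfl⟩ := (flatten N L M).surjective i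
  obtain ⟨y, rfl⟩ := (flatten N L M).surjective j
  rw [Matrix.reindex_apply, Matrix.submatrix_apply, Equiv.symm_apply_apply, Equiv.symm_apply_apply, fineOp,
    Matrix.add_apply, Matrix.smul_apply, lapF_scale, Matrix.smul_apply, lapF_flatten, blockProj_flatten,
    Matrix.smul_apply, Matrix.add_apply, Matrix.smul_apply, smul_eq_mul, smul_eq_mul, smul_eq_mul, smul_eq_mul,
    mul_add, ← mul_assoc, mul_comm ((L : ℝ) ^ 2) (a₂ * _), mul_assoc a₂, inv_mul_cancel₀ hL2, mul_one]

/-- `c(−Δ) + m² + b·Q₂^*Q₂` is invertible on the nested torus (`≥ m²`). [cite: King1986, (2.13) p.653] -/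
theorem isUnit_lapF_add_blockProj₂ {b c m2 : ℝ} (hb : 0 ≤ b) (hc : 0 ≤ c) (hm : 0 < m2) :
    IsUnit (lapF (fine N (fine L M)) c m2 + b • blockProj₂ N L M) := by
  refine QGQInverse.isUnit_of_coercive (γ := m2) hm ?_
  intro x
  have h1 := lapF_coercive (fine N (fine L M)) c m2 hc x
  have h2 : 0 ≤ x ⬝ᵥ (blockProj₂ N L M *ᵥ x) := by
    rw [blockProj₂, Matrix.smul_mulVec, dotProduct_smul, smul_eq_mul, ← Matrix.mulVec_mulVec,
      Matrix.dotProduct_mulVec, ← Matrix.mulVec_transpose, Matrix.transpose_transpose]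
    exact mul_nonneg (by positivity) (Finset.sum_nonneg fun i _ => mul_self_nonneg _)
  rw [Matrix.add_mulVec, dotProduct_add, Matrix.smul_mulVec, dotProduct_smul, smul_eq_mul]
  nlinarith

/-- **(2.20) for the splitting**: `constrainedProp (N·L) M (L²b) (L²c) (L²m²) (flatten x) (flatten y) = (L^d∕L²)·
constrainedProp₂ N L M a₁ a c m² x y`, `b = nextLevelCoeff a a₁ L` — the level-`(k+1)` propagator in its own units on the
flat torus is `(ε′∕ε)^{2−d} = L^{d−2}` times the splitting's level-`k`-unit object. [cite: King1986, (2.13) p.653, (2.20) p.654] -/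
theorem constrainedProp_flatten {a a₁ c m2 : ℝ} (ha : 0 < a) (ha₁ : 0 < a₁) (hc : 0 ≤ c) (hm : 0 < m2)
    (x y : Tor (fine N (fine L M))) :
    constrainedProp (N * L) M (((L : ℝ) ^ 2) * nextLevelCoeff a a₁ L) (((L : ℝ) ^ 2) * c) (((L : ℝ) ^ 2) * m2)
        (flatten N L M x) (flatten N L M y)
      = (L : ℝ) ^ d / (L : ℝ) ^ 2 * constrainedProp₂ N L M a₁ a c m2 x y := by
  have hL0 : (0 : ℝ) < L := by exact_mod_cast Nat.pos_of_ne_zero (NeZero.ne L)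
  have hL2 : ((L : ℝ) ^ 2) ≠ 0 := pow_ne_zero _ hL0.ne'
  have hb : 0 ≤ nextLevelCoeff a a₁ L := by unfold nextLevelCoeff; positivity
  set T := lapF (fine N (fine L M)) c m2 + (nextLevelCoeff a a₁ L) • blockProj₂ N L M with hT
  -- the flat operator is the re-indexed `L²·T`
  have hre : fineOp (N * L) M (((L : ℝ) ^ 2) * nextLevelCoeff a a₁ L) (((L : ℝ) ^ 2) * c) (((L : ℝ) ^ 2) * m2)
      = Matrix.reindex (flatten N L M) (flatten N L M) (((L : ℝ) ^ 2) • T) := by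
    rw [fineOp_succ_eq_reindex, hT, mul_comm ((L : ℝ) ^ 2) (nextLevelCoeff a a₁ L), mul_assoc,
      mul_inv_cancel₀ hL2, mul_one]
  -- `(L²·T)⁻¹ = L⁻²·T⁻¹`
  have hTu : IsUnit T.det := (Matrix.isUnit_iff_isUnit_det _).mp (isUnit_lapF_add_blockProj₂ N L M hb hc hm)
  have hinv : (((L : ℝ) ^ 2) • T)⁻¹ = (((L : ℝ) ^ 2)⁻¹) • T⁻¹ := by
    refine Matrix.inv_eq_right_inv ?_
    rw [Matrix.smul_mul, Matrix.mul_smul, smul_smul, mul_inv_cancel₀ hL2, one_smul, Matrix.mul_nonsing_inv T hTu]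
  rw [constrainedProp, constrainedProp₂, ← hT, Matrix.smul_apply, Matrix.smul_apply, hre, Matrix.inv_reindex, hinv,
    Matrix.reindex_apply, Matrix.submatrix_apply, Equiv.symm_apply_apply, Equiv.symm_apply_apply, Matrix.smul_apply,
    smul_eq_mul, smul_eq_mul, smul_eq_mul, Nat.cast_mul, mul_pow]
  field_simp

/-- **KING'S `G^ε_{k+1}` BY NAME**: with `a₁ = a_k = aK a L k` (`k ≥ 1`, `L ≥ 2`), `c = N²` (so `L²c = (NL)²`) and `L²·b =
a_{k+1}` (`nextLevelCoeff_aK`), `constrainedProp (N·L) M (aK a L (k+1)) ((NL)²) (L²m²) (flatten x) (flatten y) = (L^d∕L²)·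
constrainedProp₂ N L M (aK a L k) a (N²) m² x y` — the left side is (2.13) at level `k + 1` in its own units (`(NL)^d·A₀⁻¹` on
the flat torus with `N·L` fine points per block, mass `L²m²`). [cite: King1986, (2.13) p.653, (2.20) p.654] -/
theorem constrainedProp_succ_flatten {a m2 : ℝ} (ha : 0 < a) (hL : 2 ≤ L) {k : ℕ} (hk : 1 ≤ k) (hm : 0 < m2)
    (x y : Tor (fine N (fine L M))) :
    constrainedProp (N * L) M (aK a L (k + 1)) (((N * L : ℕ) : ℝ) ^ 2) (((L : ℝ) ^ 2) * m2)
        (flatten N L M x) (flatten N L M y)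
      = (L : ℝ) ^ d / (L : ℝ) ^ 2 * constrainedProp₂ N L M (aK a L k) a ((N : ℝ) ^ 2) m2 x y := by
  have hLr : (1 : ℝ) < L := by exact_mod_cast (show 1 < L by omega)
  have hL2 : ((L : ℝ) ^ 2) ≠ 0 := pow_ne_zero _ (by positivity)
  have h1 : aK a L (k + 1) = ((L : ℝ) ^ 2) * nextLevelCoeff a (aK a L k) L := by
    rw [nextLevelCoeff_aK ha hLr hk, mul_div_cancel₀ _ hL2]
  have h2 : (((N * L : ℕ) : ℝ) ^ 2) = ((L : ℝ) ^ 2) * ((N : ℝ) ^ 2) := by push_cast; ring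
  rw [h1, h2]
  exact constrainedProp_flatten N L M ha (aK_pos ha hLr hk) (sq_nonneg _) hm x y

/-- **(2.17), ONE STEP, EVERYTHING BY NAME**: `L^{2−d}·G^ε_{k+1}[own units](flatten x, flatten y) − G^ε_k(x, y) =
Σ_w (Σ_z ℋ_k(x, z)·C^{(k)}(z, w))·ℋ_k(y, w)` — King's `G^ε_{(k)} = G^ε_{k+1} − G^ε_k = a_k²G^ε_kQ_k^*·C^{(k)}·Q_kG^ε_k` with both
propagators the tree's `(·)^d·(fineOp …)⁻¹` at consecutive block sizes, the minimiser the tree's `minimiser`, and `C^{(k)} =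
(Δ^{(k)} + aL⁻²Q^*Q)⁻¹`. [cite: King1986, (2.17) p.653, (2.20) p.654, (4.42) p.675] -/
theorem king217_oneStep {a m2 : ℝ} (ha : 0 < a) (hL : 2 ≤ L) {k : ℕ} (hk : 1 ≤ k) (hm : 0 < m2)
    (x y : Tor (fine N (fine L M))) :
    (L : ℝ) ^ 2 / (L : ℝ) ^ d
          * constrainedProp (N * L) M (aK a L (k + 1)) (((N * L : ℕ) : ℝ) ^ 2) (((L : ℝ) ^ 2) * m2)
              (flatten N L M x) (flatten N L M y)
        - constrainedProp N (fine L M) (aK a L k) ((N : ℝ) ^ 2) m2 x y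
      = ∑ w, (∑ z, minimiser N (fine L M) (aK a L k) ((N : ℝ) ^ 2) m2 (Pi.single z 1) x
                * oneStepCov N L M (aK a L k) a ((N : ℝ) ^ 2) m2 z w)
          * minimiser N (fine L M) (aK a L k) ((N : ℝ) ^ 2) m2 (Pi.single w 1) y := by
  have hLr : (1 : ℝ) < L := by exact_mod_cast (show 1 < L by omega)
  have hL0 : (0 : ℝ) < L := by positivity
  have hLd : ((L : ℝ) ^ d) ≠ 0 := pow_ne_zero _ hL0.ne'
  have hL2 : ((L : ℝ) ^ 2) ≠ 0 := pow_ne_zero _ hL0.ne'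
  rw [constrainedProp_succ_flatten N L M ha hL hk hm, ← mul_assoc,
    show (L : ℝ) ^ 2 / (L : ℝ) ^ d * ((L : ℝ) ^ d / (L : ℝ) ^ 2) = 1 by field_simp, one_mul]
  exact constrainedProp₂_sub_apply_minimiser N L M ha (aK_pos ha hLr hk) (sq_nonneg _) hm x y

end TwoLevel

end Torus

end Literature.MathematicalPhysics.QuantumFieldTheory.King1986
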